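import Mathlib
import Literature.NumberTheory.LFunctions.KloostermanPrimePower
import HarnessLib

/-!
# Bilinear forms with Kloosterman fractions: reduction to `(n, k) = 1` (Bettin–Chandee §2, first step)

Topic `NumberTheory/LFunctions`.  For the bilinear form of Duke–Friedlander–Iwaniec,
`B(M, N, k; α, β) = ∑_{m ≤ 2M, n ≤ 2N, (m,n)=1} α_m β_n e(k m̄/n)` (`m̄ m ≡ 1 (mod n)`; the named fact
`DukeFriedlanderIwaniec1997_bilinearKloostermanFractions` of `DeterminantEquationDFI.lean` is the
case with the twist `e(X/mn)`), S. Bettin, V. Chandee, *Trilinear forms with Kloosterman fractions*,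
Adv. Math. 328 (2018), §2, begin: "First, we notice that we can assume that `β_n` is supported on
integers coprime to `ϑ`, as can be seen by pulling out the common factor between `n` and `ϑ` and
applying the Cauchy–Schwarz inequality."  This file PROVES that step, with every object explicit:

* `DFI_sum_box_eq_sum_divisors_gcd` — regrouping a sum over `1 ≤ n ≤ 2N` by `d = (n, K)`:
  `∑_{n ≤ 2N} f(n) = ∑_{d ∣ K} ∑_{n' ≤ 2N/d, (n', K/d) = 1} f(d n')`;
* `DFI_kloostermanPhase_reduce` — pulling out the common factor: for `(m, dn') = 1` and `d ∣ k`,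
  `e(k · m̄^{(dn')}/(dn')) = e((k/d) · m̄^{(n')}/n')`;
* `DFI_bilinear_eq_sum_divisors` — hence
  `B(M, N, k; α, β) = ∑_{d ∣ k} B(M, N/d, k/d; α·1_{(m,d)=1}, n' ↦ β_{dn'} 1_{(n',k/d)=1})`;
* `DFI_bilinear_le_norm_mul_sqrt_C` — Cauchy–Schwarz in `m` ((bfc) of the source):
  `‖B(M,N,k;α,β)‖ ≤ ‖α‖ (∑_m |∑_{(m,n)=1} β_n e(k m̄/n)|²)^{1/2}`;
* `DFI_bilinear_bound_of_coprime_case` — Cauchy–Schwarz over `d`: a bound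
  `‖B(M,N,k;α,β)‖ ≤ ‖α‖ ‖β‖ G(M,N,k)` valid for `β` supported on `(n, k) = 1`, with `G ≥ 0`
  non-increasing under `(N, k) ↦ (N/d, k/d)`, gives `‖B‖ ≤ τ(|k|)^{1/2} ‖α‖ ‖β‖ G(M,N,k)` in
  general (`∑_{d∣k} ‖β^{(d)}‖² = ‖β‖²`).

## References

* S. Bettin, V. Chandee, Adv. Math. 328 (2018) 1234–1262 (arXiv:1502.00769), §2. [BettinChandee2018]
* W. Duke, J. Friedlander, H. Iwaniec, Invent. Math. 128 (1997) 23–43. [DukeFriedlanderIwaniec1997]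
-/

noncomputable section

open Finset

namespace Literature.NumberTheory.LFunctions

/-- **Regrouping by the gcd with `K`**: for `K ≠ 0`, `N ≥ 0` and any `f`,
`∑_{1 ≤ n ≤ 2N} f(n) = ∑_{d ∣ K} ∑_{1 ≤ n' ≤ 2N/d, (n', K/d) = 1} f(d n')` (`n = d n'`, `d = (n, K)`).
[folklore] -/
theorem DFI_sum_box_eq_sum_divisors_gcd {E : Type*} [AddCommMonoid E] {K : ℕ} (hK : K ≠ 0)
    (N : ℝ) (f : ℕ → E) :
    ∑ n ∈ Icc 1 ⌊2 * N⌋₊, f n =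
      ∑ d ∈ K.divisors, ∑ n' ∈ (Icc 1 ⌊2 * (N / d)⌋₊).filter (fun n' => n'.Coprime (K / d)),
        f (d * n') := by
  rw [← Finset.sum_fiberwise_of_maps_to (g := fun n => Nat.gcd n K) (t := K.divisors)
    (fun n _ => Nat.mem_divisors.mpr ⟨Nat.gcd_dvd_right n K, hK⟩)]
  refine Finset.sum_congr rfl fun d hd => ?_
  have hd0 : 0 < d := Nat.pos_of_mem_divisors hd
  have hdK : d ∣ K := Nat.dvd_of_mem_divisors hd
  have hfloor : ⌊2 * (N / d)⌋₊ = ⌊2 * N⌋₊ / d := by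
    rw [show (2 : ℝ) * (N / d) = 2 * N / d by ring, Nat.floor_div_natCast]
  refine Finset.sum_nbij' (fun n => n / d) (fun n' => d * n') (fun n hn => ?_) (fun n' hn' => ?_)
    (fun n hn => ?_) (fun n' _ => ?_) (fun n hn => ?_)
  · rw [Finset.mem_filter, Finset.mem_Icc] at hn
    obtain ⟨⟨h1, h2⟩, hg⟩ := hn
    have hdn : d ∣ n := hg ▸ Nat.gcd_dvd_left n K
    rw [Finset.mem_filter, Finset.mem_Icc, hfloor]
    refine ⟨⟨Nat.div_pos (Nat.le_of_dvd (by omega) hdn) hd0, Nat.div_le_div_right h2⟩, ?_⟩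
    show Nat.gcd (n / d) (K / d) = 1
    rw [Nat.gcd_div hdn hdK, hg, Nat.div_self hd0]
  · rw [Finset.mem_filter, Finset.mem_Icc, hfloor] at hn'
    obtain ⟨⟨h1, h2⟩, hc⟩ := hn'
    rw [Finset.mem_filter, Finset.mem_Icc]
    refine ⟨⟨?_, ?_⟩, ?_⟩
    · have := Nat.mul_le_mul hd0 h1; simpa using this
    · calc d * n' ≤ d * (⌊2 * N⌋₊ / d) := Nat.mul_le_mul_left d h2
        _ ≤ ⌊2 * N⌋₊ := Nat.mul_div_le _ _
    · show Nat.gcd (d * n') K = d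
      conv_lhs => rw [← Nat.mul_div_cancel' hdK]
      rw [Nat.gcd_mul_left, Nat.Coprime.gcd_eq_one hc, mul_one]
  · rw [Finset.mem_filter] at hn
    have hdn : d ∣ n := hn.2 ▸ Nat.gcd_dvd_left n K
    exact Nat.mul_div_cancel' hdn
  · exact Nat.mul_div_cancel_left n' hd0
  · rw [Finset.mem_filter] at hn
    have hdn : d ∣ n := hn.2 ▸ Nat.gcd_dvd_left n K
    rw [Nat.mul_div_cancel' hdn]

/-- **Pulling out the common factor**: for `d, n' ≥ 1`, `(m, dn') = 1` and `d ∣ k`,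
`e(k · m̄^{(dn')}/(dn')) = e((k/d) · m̄^{(n')}/n')`, where `m̄^{(q)}` is the inverse of `m` modulo
`q` (the two inverses agree modulo `n'`). [folklore] -/
theorem DFI_kloostermanPhase_reduce {d n' : ℕ} (hd : 0 < d) (hn : 0 < n') {m : ℕ}
    (hm : m.Coprime (d * n')) {k : ℤ} (hk : (d : ℤ) ∣ k) :
    Complex.exp (2 * Real.pi * Complex.I *
        ((k : ℂ) * ((((m : ZMod (d * n'))⁻¹).val : ℕ) : ℂ) / ((d * n' : ℕ) : ℂ))) =
      Complex.exp (2 * Real.pi * Complex.I *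
        (((k / d : ℤ) : ℂ) * ((((m : ZMod n')⁻¹).val : ℕ) : ℂ) / (n' : ℂ))) := by
  obtain ⟨k', rfl⟩ := hk
  have hdz : (d : ℤ) ≠ 0 := by exact_mod_cast hd.ne'
  rw [Int.mul_ediv_cancel_left _ hdz]
  haveI : NeZero (d * n') := ⟨(Nat.mul_pos hd hn).ne'⟩
  haveI : NeZero n' := ⟨hn.ne'⟩
  set u : ℕ := ((m : ZMod (d * n'))⁻¹).val with hu
  set u' : ℕ := ((m : ZMod n')⁻¹).val with hu'
  -- the two inverses agree modulo `n'`
  have hmod : u % n' = u' := by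
    have hunit : IsUnit ((m : ℕ) : ZMod (d * n')) := (ZMod.isUnit_iff_coprime m (d * n')).mpr hm
    have hcast := ZMod.cast_inv_of_isUnit (q := d * n') (q' := n') (dvd_mul_left n' d) hunit
    rw [ZMod.cast_eq_val, ZMod.cast_natCast (dvd_mul_left n' d)] at hcast
    have h2 := congrArg ZMod.val hcast
    rwa [ZMod.val_natCast] at h2
  have hdecomp : (u : ℂ) = (u' : ℂ) + (n' : ℂ) * ((u / n' : ℕ) : ℂ) := by
    have := Nat.mod_add_div u n'
    rw [hmod] at this
    exact_mod_cast this.symm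
  have hn0 : (n' : ℂ) ≠ 0 := by exact_mod_cast hn.ne'
  have hd0 : (d : ℂ) ≠ 0 := by exact_mod_cast hd.ne'
  have key : 2 * (Real.pi : ℂ) * Complex.I *
      ((((d : ℤ) * k' : ℤ) : ℂ) * (u : ℂ) / ((d * n' : ℕ) : ℂ)) =
      2 * Real.pi * Complex.I * ((k' : ℂ) * (u' : ℂ) / (n' : ℂ)) +
        ((k' * (u / n' : ℕ) : ℤ) : ℂ) * (2 * Real.pi * Complex.I) := by
    rw [hdecomp]
    simp only [Int.cast_mul, Int.cast_natCast, Nat.cast_mul]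
    field_simp
  rw [key, Complex.exp_add, Complex.exp_int_mul_two_pi_mul_I, mul_one]

/-- **The bilinear form regrouped by `d = (n, k)`**:
`B(M,N,k;α,β) = ∑_{d ∣ k} B(M, N/d, k/d; α 1_{(·,d)=1}, n' ↦ β_{dn'} 1_{(n',k/d)=1})`, where
`B(M,N,k;α,β) = ∑_{m ≤ 2M} ∑_{n ≤ 2N} [(m,n)=1] α_m β_n e(k m̄/n)`.
[cite: BettinChandee2018, §2] -/
theorem DFI_bilinear_eq_sum_divisors (M N : ℝ) {k : ℤ} (hk : k ≠ 0) (α β : ℕ → ℂ) :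
    (∑ m ∈ Icc 1 ⌊2 * M⌋₊, ∑ n ∈ Icc 1 ⌊2 * N⌋₊,
      if m.Coprime n then
        α m * β n * Complex.exp (2 * Real.pi * Complex.I *
          ((k : ℂ) * ((((m : ZMod n)⁻¹).val : ℕ) : ℂ) / (n : ℂ)))
      else 0) =
    ∑ d ∈ k.natAbs.divisors, ∑ m ∈ Icc 1 ⌊2 * M⌋₊, ∑ n' ∈ Icc 1 ⌊2 * (N / d)⌋₊,
      if m.Coprime n' then
        (if m.Coprime d then α m else 0) *
          (if n'.Coprime (k.natAbs / d) then β (d * n') else 0) *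
          Complex.exp (2 * Real.pi * Complex.I *
            (((k / d : ℤ) : ℂ) * ((((m : ZMod n')⁻¹).val : ℕ) : ℂ) / (n' : ℂ)))
      else 0 := by
  have hK : k.natAbs ≠ 0 := Int.natAbs_ne_zero.mpr hk
  conv_rhs => rw [Finset.sum_comm]
  refine Finset.sum_congr rfl fun m _ => ?_
  rw [DFI_sum_box_eq_sum_divisors_gcd hK N]
  refine Finset.sum_congr rfl fun d hd => ?_
  have hd0 : 0 < d := Nat.pos_of_mem_divisors hd
  have hdk : (d : ℤ) ∣ k := Int.natCast_dvd.mpr (Nat.dvd_of_mem_divisors hd)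
  rw [Finset.sum_filter]
  refine Finset.sum_congr rfl fun n' hn' => ?_
  have hn0 : 0 < n' := (Finset.mem_Icc.mp hn').1
  by_cases hc : n'.Coprime (k.natAbs / d)
  · rw [if_pos hc, if_pos hc]
    by_cases hmn : m.Coprime (d * n')
    · obtain ⟨hmd, hmn'⟩ := Nat.coprime_mul_iff_right.mp hmn
      rw [if_pos hmn, if_pos hmn', if_pos hmd, DFI_kloostermanPhase_reduce hd0 hn0 hmn hdk]
    · rw [if_neg hmn]
      by_cases hmn' : m.Coprime n'
      · have hmd : ¬ m.Coprime d := fun h => hmn (Nat.Coprime.mul_right h hmn')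
        rw [if_pos hmn', if_neg hmd, zero_mul, zero_mul]
      · rw [if_neg hmn']
  · rw [if_neg hc, if_neg hc]
    split_ifs <;> simp

/-- `∑_{d ∣ k} ‖β^{(d)}‖² = ‖β‖²` for `β^{(d)}(n') = β_{dn'} 1_{(n',k/d)=1}` (the map `(d, n') ↦ dn'`
is a bijection onto `1 ≤ n ≤ 2N`). [folklore] -/
theorem DFI_sum_divisors_normSq_eq {k : ℤ} (hk : k ≠ 0) (N : ℝ) (β : ℕ → ℂ) :
    ∑ d ∈ k.natAbs.divisors, ∑ n' ∈ Icc 1 ⌊2 * (N / d)⌋₊,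
        ‖(if n'.Coprime (k.natAbs / d) then β (d * n') else 0)‖ ^ 2 =
      ∑ n ∈ Icc 1 ⌊2 * N⌋₊, ‖β n‖ ^ 2 := by
  rw [DFI_sum_box_eq_sum_divisors_gcd (Int.natAbs_ne_zero.mpr hk) N (fun n => ‖β n‖ ^ 2)]
  refine Finset.sum_congr rfl fun d _ => ?_
  rw [Finset.sum_filter]
  refine Finset.sum_congr rfl fun n' _ => ?_
  split_ifs <;> simp

/-- **Reduction to coprime support** (Cauchy–Schwarz over `d ∣ k`).  Suppose that for all
`M, N ≥ 1/2`, `k ≠ 0` and all `α` supported in `(M, 2M]`, `β` supported in `(N, 2N]` AND on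
integers coprime to `k`, `‖B(M,N,k;α,β)‖ ≤ ‖α‖ ‖β‖ G(M,N,k)` with `G ≥ 0` and
`G(M, N/d, k/d) ≤ G(M, N, k)` for `d ∣ k`, `d ≥ 1`.  Then for all `α, β` supported in the boxes,
`‖B(M,N,k;α,β)‖ ≤ τ(|k|)^{1/2} ‖α‖ ‖β‖ G(M,N,k)`. [cite: BettinChandee2018, §2] -/
theorem DFI_bilinear_bound_of_coprime_case (G : ℝ → ℝ → ℤ → ℝ) (hG0 : ∀ M N k, 0 ≤ G M N k)
    (hGmono : ∀ (M N : ℝ) (k : ℤ) (d : ℕ), 0 < d → (d : ℤ) ∣ k → G M (N / d) (k / d) ≤ G M N k)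
    (hcore : ∀ (M N : ℝ), 1 / 2 ≤ M → 1 / 2 ≤ N → ∀ (k : ℤ), k ≠ 0 → ∀ (α β : ℕ → ℂ),
      (∀ m : ℕ, α m ≠ 0 → M < m ∧ (m : ℝ) ≤ 2 * M) →
      (∀ n : ℕ, β n ≠ 0 → N < n ∧ (n : ℝ) ≤ 2 * N) →
      (∀ n : ℕ, β n ≠ 0 → n.Coprime k.natAbs) →
      ‖∑ m ∈ Icc 1 ⌊2 * M⌋₊, ∑ n ∈ Icc 1 ⌊2 * N⌋₊,
          if m.Coprime n then
            α m * β n * Complex.exp (2 * Real.pi * Complex.I *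
              ((k : ℂ) * ((((m : ZMod n)⁻¹).val : ℕ) : ℂ) / (n : ℂ)))
          else 0‖ ≤
        Real.sqrt (∑ m ∈ Icc 1 ⌊2 * M⌋₊, ‖α m‖ ^ 2) *
          Real.sqrt (∑ n ∈ Icc 1 ⌊2 * N⌋₊, ‖β n‖ ^ 2) * G M N k)
    (M N : ℝ) (hM : 1 / 2 ≤ M) (hN : 1 / 2 ≤ N) (k : ℤ) (hk : k ≠ 0) (α β : ℕ → ℂ)
    (hα : ∀ m : ℕ, α m ≠ 0 → M < m ∧ (m : ℝ) ≤ 2 * M)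
    (hβ : ∀ n : ℕ, β n ≠ 0 → N < n ∧ (n : ℝ) ≤ 2 * N) :
    ‖∑ m ∈ Icc 1 ⌊2 * M⌋₊, ∑ n ∈ Icc 1 ⌊2 * N⌋₊,
        if m.Coprime n then
          α m * β n * Complex.exp (2 * Real.pi * Complex.I *
            ((k : ℂ) * ((((m : ZMod n)⁻¹).val : ℕ) : ℂ) / (n : ℂ)))
        else 0‖ ≤
      Real.sqrt (k.natAbs.divisors.card) * Real.sqrt (∑ m ∈ Icc 1 ⌊2 * M⌋₊, ‖α m‖ ^ 2) *
        Real.sqrt (∑ n ∈ Icc 1 ⌊2 * N⌋₊, ‖β n‖ ^ 2) * G M N k := by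
  have hN0 : 0 < N := by linarith
  rw [DFI_bilinear_eq_sum_divisors M N hk α β]
  -- notation for the pieces
  set nα : ℝ := Real.sqrt (∑ m ∈ Icc 1 ⌊2 * M⌋₊, ‖α m‖ ^ 2) with hnα
  set nβd : ℕ → ℝ := fun d => Real.sqrt (∑ n' ∈ Icc 1 ⌊2 * (N / d)⌋₊,
    ‖(if n'.Coprime (k.natAbs / d) then β (d * n') else 0)‖ ^ 2) with hnβd
  -- each piece is bounded by `nα · nβd d · G M N k`
  have hpiece : ∀ d ∈ k.natAbs.divisors,
      ‖∑ m ∈ Icc 1 ⌊2 * M⌋₊, ∑ n' ∈ Icc 1 ⌊2 * (N / d)⌋₊,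
        if m.Coprime n' then
          (if m.Coprime d then α m else 0) *
            (if n'.Coprime (k.natAbs / d) then β (d * n') else 0) *
            Complex.exp (2 * Real.pi * Complex.I *
              (((k / d : ℤ) : ℂ) * ((((m : ZMod n')⁻¹).val : ℕ) : ℂ) / (n' : ℂ)))
        else 0‖ ≤ nα * nβd d * G M N k := by
    intro d hd
    have hd0 : 0 < d := Nat.pos_of_mem_divisors hd
    have hdk : (d : ℤ) ∣ k := Int.natCast_dvd.mpr (Nat.dvd_of_mem_divisors hd)
    have hd0r : (0 : ℝ) < d := by exact_mod_cast hd0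
    by_cases hNd : 1 / 2 ≤ N / d
    · -- apply the coprime-case bound at `(M, N/d, k/d)`
      have hkd : k / d ≠ 0 := by
        intro h0
        have : k = 0 := by
          rw [← Int.ediv_mul_cancel hdk, h0, zero_mul]
        exact hk this
      have hα' : ∀ m : ℕ, (if m.Coprime d then α m else 0) ≠ 0 → M < m ∧ (m : ℝ) ≤ 2 * M := by
        intro m hm
        refine hα m fun h0 => hm ?_
        simp [h0]
      have hβ' : ∀ n' : ℕ, (if n'.Coprime (k.natAbs / d) then β (d * n') else 0) ≠ 0 →
          N / d < n' ∧ (n' : ℝ) ≤ 2 * (N / d) := by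
        intro n' hn'
        by_cases hc : n'.Coprime (k.natAbs / d)
        · rw [if_pos hc] at hn'
          obtain ⟨h1, h2⟩ := hβ (d * n') hn'
          push_cast at h1 h2
          constructor
          · rw [div_lt_iff₀ hd0r]; linarith
          · rw [show 2 * (N / d) = 2 * N / d by ring, le_div_iff₀ hd0r]; linarith
        · exact absurd (by rw [if_neg hc]) hn'
      have hβ'' : ∀ n' : ℕ, (if n'.Coprime (k.natAbs / d) then β (d * n') else 0) ≠ 0 →
          n'.Coprime (k / d).natAbs := by
        intro n' hn'
        by_cases hc : n'.Coprime (k.natAbs / d)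
        · rwa [Int.natAbs_ediv_of_dvd hdk, Int.natAbs_natCast]
        · exact absurd (by rw [if_neg hc]) hn'
      have h := hcore M (N / d) hM hNd (k / d) hkd _ _ hα' hβ' hβ''
      refine h.trans ?_
      have hαle : Real.sqrt (∑ m ∈ Icc 1 ⌊2 * M⌋₊, ‖(if m.Coprime d then α m else 0)‖ ^ 2) ≤ nα := by
        refine Real.sqrt_le_sqrt (Finset.sum_le_sum fun m _ => ?_)
        split_ifs <;> simp
      have hG := hGmono M N k d hd0 hdk
      have := hG0 M (N / d) (k / d)
      gcongr
    · -- `N/d < 1/2`: the box `1 ≤ n' ≤ 2N/d` is empty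
      have hfl : ⌊2 * (N / d)⌋₊ = 0 := Nat.floor_eq_zero.mpr (by linarith [not_le.mp hNd])
      rw [hfl]
      simp only [show Icc 1 0 = (∅ : Finset ℕ) by rfl, Finset.sum_empty, Finset.sum_const_zero,
        norm_zero]
      have := hG0 M N k
      positivity
  -- Cauchy–Schwarz over `d`
  have hCS : ∑ d ∈ k.natAbs.divisors, nβd d ≤
      Real.sqrt (k.natAbs.divisors.card) * Real.sqrt (∑ n ∈ Icc 1 ⌊2 * N⌋₊, ‖β n‖ ^ 2) := by
    have h1 : (∑ d ∈ k.natAbs.divisors, nβd d) ^ 2 ≤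
        k.natAbs.divisors.card * ∑ n ∈ Icc 1 ⌊2 * N⌋₊, ‖β n‖ ^ 2 := by
      calc (∑ d ∈ k.natAbs.divisors, nβd d) ^ 2
          ≤ k.natAbs.divisors.card * ∑ d ∈ k.natAbs.divisors, nβd d ^ 2 := sq_sum_le_card_mul_sum_sq
        _ = k.natAbs.divisors.card * ∑ n ∈ Icc 1 ⌊2 * N⌋₊, ‖β n‖ ^ 2 := by
            rw [← DFI_sum_divisors_normSq_eq hk N β]
            congr 1
            refine Finset.sum_congr rfl fun d _ => ?_
            exact Real.sq_sqrt (Finset.sum_nonneg fun _ _ => sq_nonneg _)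
    calc ∑ d ∈ k.natAbs.divisors, nβd d = Real.sqrt ((∑ d ∈ k.natAbs.divisors, nβd d) ^ 2) :=
          (Real.sqrt_sq (Finset.sum_nonneg fun _ _ => Real.sqrt_nonneg _)).symm
      _ ≤ Real.sqrt (k.natAbs.divisors.card * ∑ n ∈ Icc 1 ⌊2 * N⌋₊, ‖β n‖ ^ 2) :=
          Real.sqrt_le_sqrt h1
      _ = _ := Real.sqrt_mul (Nat.cast_nonneg _) _
  have hG := hG0 M N k
  calc _ ≤ ∑ d ∈ k.natAbs.divisors, ‖∑ m ∈ Icc 1 ⌊2 * M⌋₊, ∑ n' ∈ Icc 1 ⌊2 * (N / d)⌋₊,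
        if m.Coprime n' then
          (if m.Coprime d then α m else 0) *
            (if n'.Coprime (k.natAbs / d) then β (d * n') else 0) *
            Complex.exp (2 * Real.pi * Complex.I *
              (((k / d : ℤ) : ℂ) * ((((m : ZMod n')⁻¹).val : ℕ) : ℂ) / (n' : ℂ)))
        else 0‖ := norm_sum_le _ _
    _ ≤ ∑ d ∈ k.natAbs.divisors, nα * nβd d * G M N k := Finset.sum_le_sum hpiece
    _ = nα * G M N k * ∑ d ∈ k.natAbs.divisors, nβd d := by
        rw [Finset.mul_sum]
        refine Finset.sum_congr rfl fun d _ => ?_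
        ring
    _ ≤ nα * G M N k * (Real.sqrt (k.natAbs.divisors.card) *
          Real.sqrt (∑ n ∈ Icc 1 ⌊2 * N⌋₊, ‖β n‖ ^ 2)) := by gcongr
    _ = _ := by ring


/-! ### Cauchy–Schwarz in `m` (Bettin–Chandee (bfc): `𝓑 ≪ ‖α‖ 𝓒₁^{1/2}`) -/

/-- **Cauchy–Schwarz for a weighted finite sum of complex numbers**:
`‖∑_{i∈s} a_i X_i‖ ≤ (∑ ‖a_i‖²)^{1/2} (∑ ‖X_i‖²)^{1/2}`. [folklore] -/
theorem DFI_norm_sum_mul_le_sqrt_mul_sqrt {ι : Type*} (s : Finset ι) (a X : ι → ℂ) :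
    ‖∑ i ∈ s, a i * X i‖ ≤
      Real.sqrt (∑ i ∈ s, ‖a i‖ ^ 2) * Real.sqrt (∑ i ∈ s, ‖X i‖ ^ 2) := by
  have h1 : ‖∑ i ∈ s, a i * X i‖ ≤ ∑ i ∈ s, ‖a i‖ * ‖X i‖ :=
    (norm_sum_le _ _).trans (le_of_eq (Finset.sum_congr rfl fun i _ => norm_mul _ _))
  have h2 : (∑ i ∈ s, ‖a i‖ * ‖X i‖) ^ 2 ≤ (∑ i ∈ s, ‖a i‖ ^ 2) * ∑ i ∈ s, ‖X i‖ ^ 2 :=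
    Finset.sum_mul_sq_le_sq_mul_sq s _ _
  have h3 : ∑ i ∈ s, ‖a i‖ * ‖X i‖ ≤
      Real.sqrt (∑ i ∈ s, ‖a i‖ ^ 2) * Real.sqrt (∑ i ∈ s, ‖X i‖ ^ 2) := by
    rw [← Real.sqrt_mul (Finset.sum_nonneg fun _ _ => sq_nonneg _)]
    calc ∑ i ∈ s, ‖a i‖ * ‖X i‖ = Real.sqrt ((∑ i ∈ s, ‖a i‖ * ‖X i‖) ^ 2) :=
          (Real.sqrt_sq (Finset.sum_nonneg fun _ _ =>
            mul_nonneg (norm_nonneg _) (norm_nonneg _))).symm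
      _ ≤ _ := Real.sqrt_le_sqrt h2
  exact h1.trans h3

/-- **`𝓑 ≤ ‖α‖ 𝓒₁^{1/2}`** for the bilinear Kloosterman-fraction form:
`‖B(M,N,k;α,β)‖ ≤ ‖α‖ (∑_{m ≤ 2M} |∑_{n ≤ 2N, (m,n)=1} β_n e(k m̄/n)|²)^{1/2}`.
[cite: BettinChandee2018, §2 (bfc)] -/
theorem DFI_bilinear_le_norm_mul_sqrt_C (M N : ℝ) (k : ℤ) (α β : ℕ → ℂ) :
    ‖∑ m ∈ Icc 1 ⌊2 * M⌋₊, ∑ n ∈ Icc 1 ⌊2 * N⌋₊,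
        if m.Coprime n then
          α m * β n * Complex.exp (2 * Real.pi * Complex.I *
            ((k : ℂ) * ((((m : ZMod n)⁻¹).val : ℕ) : ℂ) / (n : ℂ)))
        else 0‖ ≤
      Real.sqrt (∑ m ∈ Icc 1 ⌊2 * M⌋₊, ‖α m‖ ^ 2) *
        Real.sqrt (∑ m ∈ Icc 1 ⌊2 * M⌋₊, ‖∑ n ∈ Icc 1 ⌊2 * N⌋₊,
          if m.Coprime n then
            β n * Complex.exp (2 * Real.pi * Complex.I *
              ((k : ℂ) * ((((m : ZMod n)⁻¹).val : ℕ) : ℂ) / (n : ℂ)))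
          else 0‖ ^ 2) := by
  have hfac : ∀ m : ℕ, (∑ n ∈ Icc 1 ⌊2 * N⌋₊,
        if m.Coprime n then
          α m * β n * Complex.exp (2 * Real.pi * Complex.I *
            ((k : ℂ) * ((((m : ZMod n)⁻¹).val : ℕ) : ℂ) / (n : ℂ)))
        else 0) =
      α m * ∑ n ∈ Icc 1 ⌊2 * N⌋₊,
          if m.Coprime n then
            β n * Complex.exp (2 * Real.pi * Complex.I *
              ((k : ℂ) * ((((m : ZMod n)⁻¹).val : ℕ) : ℂ) / (n : ℂ)))
          else 0 := by
    intro m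
    rw [Finset.mul_sum]
    refine Finset.sum_congr rfl fun n _ => ?_
    split_ifs
    · ring
    · rw [mul_zero]
  simp_rw [hfac]
  exact DFI_norm_sum_mul_le_sqrt_mul_sqrt _ _ _

end Literature.NumberTheory.LFunctions

end
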